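import Summits.NavierStokesRegularity.NavierStokesRegularity.Theorems.FilamentSkeletonRssKelvinGateTools

/-!
# Route `FilamentSkeletonRss` · crux `TransverseReductionRJ` (stmt-NavierStokesRegularity-21221) — line `kelvin_gate`,
# stub S2 `PolynomialKelvinGate`: SIZE of the infinitesimal rotation in the line's scales (quantitative §Rate)

Helper file (theorems only, `--supports stmt-NavierStokesRegularity-21221 --as helper`), in the vocabulary of
`FilamentSkeletonRssKelvinGateDefs`.  HONEST FRAMING: bookkeeping for a HYPOTHETICAL filament-type RSS blow-up route;
nothing here bears on Navier–Stokes regularity; no stub is proved here.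

`BaseSpec.lerayLin_rotField` (file `…KelvinGateRotationKernel`) says that for every dressed base family the rotation
pair `(𝓡U⁰_p, 𝓡ₛP⁰_p)`, `𝓡V = e₃ × V − DV[e₃ × y]`, solves the linearised system with defect `𝓡r_p + Σ_j b⁰_pj 𝓡D_pj`.
This file measures the pieces in the line's weighted sup-scales:

* `norm_rotGenL_le` — `‖e₃ × v‖ ≤ ‖v‖`;
* `YBound.weighted_norm_rotField_le` — a Y-bounded field `r` (radius `R`) has `(1 + ‖y‖) ‖𝓡r(y)‖ ≤ 2R`: the defect
  `𝓡r_p` of the approximate kernel vector is `O(Cr Γ^{-k})` in the `⟨y⟩`-weighted sup norm;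
* `XBound.norm_rotField_le` — an X-bounded field `U` (radius `R`) has `‖𝓡U(y)‖ ≤ 2R` (bounded; membership of `𝓡U`
  in X itself needs the graded far-field decay `|D^m U| ≲ ⟨y⟩^{-1-m}`, which `XBound` does not record).
So the typed §Rate obstruction is QUANTITATIVE exactly where the multipliers `b⁰_p` are small (near the selected zero
of the route), with defect `≤ 2 Cr Γ^{-k} ⟨y⟩⁻¹ + Σ_j |b⁰_pj| ‖𝓡D_pj(y)‖`.
-/

set_option linter.dupNamespace false

noncomputable section

namespace Summit.NavierStokesRegularity.NavierStokesRegularity.Theorems.KelvinGate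

open Set Function
open Literature.Analysis.FluidPDE
open scoped InnerProductSpace Topology

/-- `‖e₃ × v‖ ≤ ‖v‖` (the generator kills the axial component and rotates the horizontal one). -/
theorem norm_rotGenL_le (v : EuclideanSpace ℝ (Fin 3)) : ‖rotGenL v‖ ≤ ‖v‖ := by
  rw [rotGenL_apply]
  have h1 : ‖rotGen v‖ ^ 2 = v 0 ^ 2 + v 1 ^ 2 := by
    rw [EuclideanSpace.norm_sq_eq, Fin.sum_univ_three]
    simp [rotGen, Real.norm_eq_abs, sq_abs]
    ring
  have h2 : ‖v‖ ^ 2 = v 0 ^ 2 + v 1 ^ 2 + v 2 ^ 2 := by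
    rw [EuclideanSpace.norm_sq_eq, Fin.sum_univ_three]
    simp [Real.norm_eq_abs, sq_abs]
  have h3 : ‖rotGen v‖ ^ 2 ≤ ‖v‖ ^ 2 := by rw [h1, h2]; nlinarith [sq_nonneg (v 2)]
  exact (pow_le_pow_iff_left₀ (norm_nonneg _) (norm_nonneg _) two_ne_zero).mp h3

/-- `‖e₃ × y‖ ≤ ‖y‖` in the crux's `cross` notation. -/
theorem norm_cross_single_two_le (v : EuclideanSpace ℝ (Fin 3)) : ‖cross (EuclideanSpace.single 2 1) v‖ ≤ ‖v‖ := by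
  rw [cross_single_two_eq_rotGen, ← rotGenL_apply]; exact norm_rotGenL_le v

/-- **The rotation of a Y-bounded field is `O(R ⟨y⟩⁻¹)`:** if `YBound r R` then
`(1 + ‖y‖) ‖e₃ × r(y) − Dr(y)[e₃ × y]‖ ≤ 2R`.  Applied to the residual `r_p` of a dressed base family
(`YBound r_p (Cr Γ^{-k})`), the defect `𝓡r_p` of the §Rate approximate kernel vector is `≤ 2 Cr Γ^{-k} ⟨y⟩⁻¹`. -/
theorem YBound.weighted_norm_rotField_le {r : EuclideanSpace ℝ (Fin 3) → EuclideanSpace ℝ (Fin 3)} {R : ℝ}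
    (h : YBound r R) (y : EuclideanSpace ℝ (Fin 3)) :
    (1 + ‖y‖) * ‖cross (EuclideanSpace.single 2 1) (r y) - fderiv ℝ r y (cross (EuclideanSpace.single 2 1) y)‖ ≤ 2 * R := by
  have hR : 0 ≤ R := h.nonneg
  have h1 : (1 + ‖y‖) ^ 2 * ‖r y‖ ≤ R := (h.2 y).1
  have h2 : (1 + ‖y‖) ^ 2 * ‖fderiv ℝ r y‖ ≤ R := (h.2 y).2
  have hy : 0 ≤ ‖y‖ := norm_nonneg y
  have hA : (1 + ‖y‖) * ‖cross (EuclideanSpace.single 2 1) (r y)‖ ≤ R := by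
    calc (1 + ‖y‖) * ‖cross (EuclideanSpace.single 2 1) (r y)‖ ≤ (1 + ‖y‖) * ‖r y‖ :=
          mul_le_mul_of_nonneg_left (norm_cross_single_two_le _) (by positivity)
      _ ≤ (1 + ‖y‖) ^ 2 * ‖r y‖ := by
          rw [sq]; exact mul_le_mul_of_nonneg_right (le_mul_of_one_le_left (by positivity) (by linarith)) (norm_nonneg _)
      _ ≤ R := h1
  have hB : (1 + ‖y‖) * ‖fderiv ℝ r y (cross (EuclideanSpace.single 2 1) y)‖ ≤ R := by
    calc (1 + ‖y‖) * ‖fderiv ℝ r y (cross (EuclideanSpace.single 2 1) y)‖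
        ≤ (1 + ‖y‖) * (‖fderiv ℝ r y‖ * ‖y‖) := mul_le_mul_of_nonneg_left
          ((ContinuousLinearMap.le_opNorm _ _).trans (mul_le_mul_of_nonneg_left (norm_cross_single_two_le y) (norm_nonneg _)))
          (by positivity)
      _ ≤ (1 + ‖y‖) ^ 2 * ‖fderiv ℝ r y‖ := by
          rw [sq]; nlinarith [norm_nonneg (fderiv ℝ r y), mul_nonneg hy (norm_nonneg (fderiv ℝ r y))]
      _ ≤ R := h2
  calc (1 + ‖y‖) * ‖cross (EuclideanSpace.single 2 1) (r y) - fderiv ℝ r y (cross (EuclideanSpace.single 2 1) y)‖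
      ≤ (1 + ‖y‖) * (‖cross (EuclideanSpace.single 2 1) (r y)‖ + ‖fderiv ℝ r y (cross (EuclideanSpace.single 2 1) y)‖) :=
        mul_le_mul_of_nonneg_left (norm_sub_le _ _) (by positivity)
    _ ≤ 2 * R := by rw [mul_add]; linarith

/-- **The rotation of an X-bounded field is bounded:** if `XBound U R` then `‖e₃ × U(y) − DU(y)[e₃ × y]‖ ≤ 2R`.
(Only boundedness: `XBound` records `|DU| ≤ R⟨y⟩⁻¹`, so `|DU[e₃ × y]| ≤ R`; decay of `𝓡U` would need graded tails.) -/
theorem XBound.norm_rotField_le {U : EuclideanSpace ℝ (Fin 3) → EuclideanSpace ℝ (Fin 3)} {R : ℝ}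
    (h : XBound U R) (y : EuclideanSpace ℝ (Fin 3)) :
    ‖cross (EuclideanSpace.single 2 1) (U y) - fderiv ℝ U y (cross (EuclideanSpace.single 2 1) y)‖ ≤ 2 * R := by
  have hR : 0 ≤ R := h.nonneg
  have h1 : (1 + ‖y‖) * ‖U y‖ ≤ R := (h.2 y).1
  have h2 : (1 + ‖y‖) * ‖fderiv ℝ U y‖ ≤ R := (h.2 y).2.1
  have hy : 0 ≤ ‖y‖ := norm_nonneg y
  have hA : ‖cross (EuclideanSpace.single 2 1) (U y)‖ ≤ R :=
    (norm_cross_single_two_le _).trans (by nlinarith [norm_nonneg (U y)])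
  have hB : ‖fderiv ℝ U y (cross (EuclideanSpace.single 2 1) y)‖ ≤ R := by
    calc ‖fderiv ℝ U y (cross (EuclideanSpace.single 2 1) y)‖ ≤ ‖fderiv ℝ U y‖ * ‖y‖ :=
          (ContinuousLinearMap.le_opNorm _ _).trans (mul_le_mul_of_nonneg_left (norm_cross_single_two_le y) (norm_nonneg _))
      _ ≤ R := by nlinarith [norm_nonneg (fderiv ℝ U y)]
  exact (norm_sub_le _ _).trans (by linarith)

end Summit.NavierStokesRegularity.NavierStokesRegularity.Theorems.KelvinGate
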